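import Mathlib
import HarnessLib
import Summits.Ventures.LatticeQCDFlow.Scaling.TiltedMarginals

/-!
# HypercontractiveDeviation — the `L²(1/π) → L⁴(π)` HYPERCONTRACTIVITY hypothesis on a relaxation
# layer and the two sup-norm-free steps of the tilted (Feynman–Kac) recursion it buys:
# `dev4 π' (ζP) ≤ ρ·massDev π' ζ` and
# `massDev π' (g·ν) ≤ ‖g²π/π'‖_{L²(π)}^{1/2}·dev4 π ν + |ν|·π[g]·√χ²(T_g π ‖ π')`

HONEST FRAMING: exact (Metropolis-corrected) sampling algorithms for lattice gauge theory;
figures of merit are autocorrelation/cost numbers at stated couplings and volumes; no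
continuum-physics claim.

Venture `LatticeQCDFlow` (cell pub-lqcd), topic `Scaling`; FANOUT row 19 (`su2-snf`, GEN-10).
OUR WORK (elementary finite sums), nothing here is cited as a fact (A. Bonami 1970, W. Beckner
1975, L. Gross 1975 — hypercontractivity — are NAMED only, for the reading of the hypothesis).
Vocabulary: the Literature's `stepLaw K μ = μK`, `IsStationary π K` (`πK = π`), Pearson
`chiSqDiv μ π = Σ (μ − π)²/π`, and this seat's `massDev π ν = ‖ν − |ν|π‖_{L²(1/π)}`
(`Scaling/TiltedMarginals`).  MODEL-FREE (any positive probability vectors `π, π'`, any weight `g`).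

WHY.  The `χ²` route to the work-MGF envelope / ESS floor (staged GEN-5/6 files of this row)
tracks the `L²(1/π_k)` deviation of the tilted marginal; multiplying a deviation by the one-time
weight `g_k = e^{−tδD}` and re-referencing it to `π_{k+1}` then costs the SUP-NORM factor
`e^{c|t|δΔD}` (`ΔD` = oscillation of the switch observable) — uninformative at production
`n_step`, where `δ·ΔD = O(1)` (HANDOFF GEN-6 (d3), GEN-9 (d3)).  Hölder removes it IF the layer
delivers its output deviation in `L⁴`: then `Σ g²π²h²/π' ≤ ‖g²π/π'‖_{L²(π)}·‖h‖²_{L⁴(π)}` and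
`‖g²π/π'‖_{L²(π)}` is an EQUILIBRIUM exponential moment of the family (a free-energy second
difference, `Scaling/HypercontractiveESSFloor`), never a supremum.

* §1 two finite-sum inequalities (`sq_sum_mul_mul_le`: Cauchy–Schwarz in `L²(π)`, squared form;
  `sqrt_sum_add_sq_div_le_add`: Minkowski in `L²(1/π')` with given bounds on the two pieces);
* §2 `dev4 π ν = ‖ν/π − |ν|‖_{L⁴(π)}` — the `L⁴(π)` norm of the deviation DENSITY of `ν` from its
  own-mass multiple of `π` (`dev4_pow_four`, `massDev_le_dev4` (Lyapunov), `dev4_mul_self`);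
* §3 **`HyperContracts K π ρ`**: for every ZERO-MASS signed measure `ξ`,
  `Σ_y π(y)·((ξK)(y)/π(y))⁴ ≤ ρ⁴·(Σ_x ξ(x)²/π(x))²`, i.e. the layer maps `L²(1/π)` deviations to
  `L⁴(π)` deviation densities with norm `ρ`.  For a `π`-reversible `K` this is
  `‖Kh‖_{L⁴(π)} ≤ ρ‖h‖_{L²(π)}` on `π`-mean-zero `h` — hypercontractivity (Bonami–Beckner–Gross)
  restricted to the orthogonal complement of constants, with operator norm `ρ`; perfect
  relaxation `K(x,·) = π` has `ρ = 0` (`hyperContracts_perfect`); `HyperContracts.mono`;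
  `HyperContracts.sum_sq_div_le` (it implies the `L²(1/π)` — `χ²` — contraction with the same `ρ`).
  Unlike a one-step log-Sobolev or entropy-to-`L²` hypothesis it TENSORISES over independent
  blocks (Beckner's lemma, named), so `ρ < 1` is dimension-free for product-type samplers;
* §4 THE TWO STEPS: `massDev_le_sqrt_sum_shift_sq_div` (the own-mass multiple is the best constant),
  `stepLaw_shift_of_stationary`, **`dev4_stepLaw_le`** (`dev4 π' (ζK) ≤ ρ·massDev π' ζ` for a
  `π'`-stationary hypercontractive `K` with unit row sums), **`massDev_tilt_le_of_dev4`**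
  (`massDev π' (g·ν) ≤ (Σ g⁴π³/π'²)^{1/4}·dev4 π ν + |Σν|·π[g]·√χ²(T_gπ ‖ π')`, `T_gπ = gπ/π[g]`),
  and their composite **`dev4_tilt_stepLaw_le`** — the deviation step of the tilted recursion
  with NO oscillation hypothesis on `g`.

NOT CLAIMED: any value of `ρ` for a lattice kernel; the tensorisation lemma itself; anything
model-specific (the Gibbs-family values of the two coefficients are `Scaling/HypercontractiveESSFloor`).
-/

namespace Summit.Ventures.LatticeQCDFlow.Scaling

open Finset
open Literature.Probability.MarkovChains (stepLaw IsStationary)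
open Literature.Probability.ImportanceSampling (chiSqDiv chiSqDiv_def chiSqDiv_eq_sum_sq_div)

variable {X : Type*} [Fintype X]

/-! ## §1 Two finite-sum inequalities -/

/-- Cauchy–Schwarz in `L²(π)`, squared form: `(Σ π u v)² ≤ (Σ π u²)·(Σ π v²)` for `π ≥ 0`. -/
theorem sq_sum_mul_mul_le {π : X → ℝ} (hπ : ∀ x, 0 ≤ π x) (u v : X → ℝ) :
    (∑ x, π x * u x * v x) ^ 2 ≤ (∑ x, π x * u x ^ 2) * ∑ x, π x * v x ^ 2 := by
  have hcs := Finset.sum_mul_sq_le_sq_mul_sq univ (fun x => Real.sqrt (π x) * u x)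
    (fun x => Real.sqrt (π x) * v x)
  have hs : ∀ x, Real.sqrt (π x) ^ 2 = π x := fun x => Real.sq_sqrt (hπ x)
  have e1 : ∀ x, Real.sqrt (π x) * u x * (Real.sqrt (π x) * v x) = π x * u x * v x := by
    intro x
    rw [show Real.sqrt (π x) * u x * (Real.sqrt (π x) * v x)
      = Real.sqrt (π x) ^ 2 * u x * v x by ring, hs x]
  have e2 : ∀ x, (Real.sqrt (π x) * u x) ^ 2 = π x * u x ^ 2 := by
    intro x; rw [mul_pow, hs x]
  have e3 : ∀ x, (Real.sqrt (π x) * v x) ^ 2 = π x * v x ^ 2 := by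
    intro x; rw [mul_pow, hs x]
  simp_rw [e1, e2, e3] at hcs
  exact hcs

/-- Minkowski in `L²(1/π')` with given bounds on the two pieces: if `‖u‖ ≤ U` and `‖v‖ ≤ V`
(`‖u‖ = √(Σ u²/π')`) then `‖u + v‖ ≤ U + V`. -/
theorem sqrt_sum_add_sq_div_le_add {π' : X → ℝ} (hπ' : ∀ x, 0 < π' x) {u v : X → ℝ}
    {U V : ℝ} (hU : Real.sqrt (∑ x, u x ^ 2 / π' x) ≤ U)
    (hV : Real.sqrt (∑ x, v x ^ 2 / π' x) ≤ V) :
    Real.sqrt (∑ x, (u x + v x) ^ 2 / π' x) ≤ U + V := by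
  set A := ∑ x, u x ^ 2 / π' x with hA
  set B := ∑ x, v x ^ 2 / π' x with hB
  set C := ∑ x, u x * v x / π' x with hC
  have hA0 : 0 ≤ A := sum_nonneg fun x _ => div_nonneg (sq_nonneg _) (hπ' x).le
  have hB0 : 0 ≤ B := sum_nonneg fun x _ => div_nonneg (sq_nonneg _) (hπ' x).le
  -- Cauchy–Schwarz for the cross term, weight π' and densities u/π', v/π'
  have hCS : C ^ 2 ≤ A * B := by
    have h := sq_sum_mul_mul_le (fun x => (hπ' x).le) (fun x => u x / π' x) (fun x => v x / π' x)
    have eC : ∑ x, π' x * (u x / π' x) * (v x / π' x) = C := by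
      rw [hC]; refine sum_congr rfl fun x _ => ?_; field_simp [(hπ' x).ne']
    have eA : ∑ x, π' x * (u x / π' x) ^ 2 = A := by
      rw [hA]; refine sum_congr rfl fun x _ => ?_; field_simp [(hπ' x).ne']
    have eB : ∑ x, π' x * (v x / π' x) ^ 2 = B := by
      rw [hB]; refine sum_congr rfl fun x _ => ?_; field_simp [(hπ' x).ne']
    rw [eC, eA, eB] at h
    exact h
  have hsum : ∑ x, (u x + v x) ^ 2 / π' x = A + 2 * C + B := by
    rw [hA, hB, hC, mul_sum, ← sum_add_distrib, ← sum_add_distrib]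
    refine sum_congr rfl fun x _ => ?_
    field_simp [(hπ' x).ne']
    ring
  have hC' : C ≤ Real.sqrt A * Real.sqrt B := by
    rw [← Real.sqrt_mul hA0]
    exact Real.le_sqrt_of_sq_le hCS
  have hle : ∑ x, (u x + v x) ^ 2 / π' x ≤ (Real.sqrt A + Real.sqrt B) ^ 2 := by
    rw [hsum, add_sq, Real.sq_sqrt hA0, Real.sq_sqrt hB0]
    linarith
  have hUV : Real.sqrt A + Real.sqrt B ≤ U + V := add_le_add hU hV
  have h0 : 0 ≤ Real.sqrt A + Real.sqrt B := add_nonneg (Real.sqrt_nonneg _) (Real.sqrt_nonneg _)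
  calc Real.sqrt (∑ x, (u x + v x) ^ 2 / π' x)
      ≤ Real.sqrt ((Real.sqrt A + Real.sqrt B) ^ 2) := Real.sqrt_le_sqrt hle
    _ = Real.sqrt A + Real.sqrt B := Real.sqrt_sq h0
    _ ≤ U + V := hUV

/-! ## §2 The `L⁴(π)` deviation density -/

/-- `dev4 π ν = ‖ν/π − |ν|‖_{L⁴(π)} = (Σ_x π(x)·(ν(x)/π(x) − Σν)⁴)^{1/4}` — the `L⁴(π)` norm of the
deviation DENSITY of `ν` from its own-mass multiple of `π` (the `L²(π)` norm of the same density is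
`massDev π ν`). -/
noncomputable def dev4 (π ν : X → ℝ) : ℝ :=
  Real.sqrt (Real.sqrt (∑ x, π x * (ν x / π x - ∑ y, ν y) ^ 4))

/-- The sum under the fourth root of `dev4` is non-negative for `π ≥ 0`. -/
theorem sum_mul_dev_pow_four_nonneg {π : X → ℝ} (hπ : ∀ x, 0 ≤ π x) (ν : X → ℝ) :
    0 ≤ ∑ x, π x * (ν x / π x - ∑ y, ν y) ^ 4 :=
  sum_nonneg fun x _ => mul_nonneg (hπ x) (by positivity)

/-- `dev4` is non-negative. -/
theorem dev4_nonneg (π ν : X → ℝ) : 0 ≤ dev4 π ν := Real.sqrt_nonneg _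

/-- `dev4⁴` is the sum it is the fourth root of (`π ≥ 0`). -/
theorem dev4_pow_four {π : X → ℝ} (hπ : ∀ x, 0 ≤ π x) (ν : X → ℝ) :
    dev4 π ν ^ 4 = ∑ x, π x * (ν x / π x - ∑ y, ν y) ^ 4 := by
  unfold dev4
  rw [show (4 : ℕ) = 2 * 2 from rfl, pow_mul, Real.sq_sqrt (Real.sqrt_nonneg _),
    Real.sq_sqrt (sum_mul_dev_pow_four_nonneg hπ ν)]

/-- `massDev²` as the `L²(π)` norm of the deviation density: `massDev π ν² = Σ π (ν/π − Σν)²`. -/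
theorem massDev_sq_eq_sum_mul_sq {π : X → ℝ} (hπ : ∀ x, 0 < π x) (ν : X → ℝ) :
    massDev π ν ^ 2 = ∑ x, π x * (ν x / π x - ∑ y, ν y) ^ 2 := by
  rw [massDev_sq hπ]
  refine sum_congr rfl fun x _ => ?_
  field_simp [(hπ x).ne']

/-- **Lyapunov**: `massDev π ν ≤ dev4 π ν` for a positive probability vector `π`
(`(Σ π h²)² ≤ Σ π h⁴ · Σ π`). -/
theorem massDev_le_dev4 {π : X → ℝ} (hπ : ∀ x, 0 < π x) (hπ1 : ∑ x, π x = 1) (ν : X → ℝ) :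
    massDev π ν ≤ dev4 π ν := by
  set h : X → ℝ := fun x => ν x / π x - ∑ y, ν y with hh
  have hπ0 : ∀ x, 0 ≤ π x := fun x => (hπ x).le
  have hcs := sq_sum_mul_mul_le hπ0 (fun x => h x ^ 2) (fun _ => 1)
  have e1 : ∑ x, π x * h x ^ 2 * 1 = massDev π ν ^ 2 := by
    rw [massDev_sq_eq_sum_mul_sq hπ]; simp [hh]
  have e2 : ∑ x, π x * (h x ^ 2) ^ 2 = dev4 π ν ^ 4 := by
    rw [dev4_pow_four hπ0]
    exact sum_congr rfl fun x _ => by rw [hh]; ring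
  have e3 : ∑ x, π x * (1:ℝ) ^ 2 = 1 := by simp [hπ1]
  rw [e1, e2, e3, mul_one, ← pow_mul, show 2 * 2 = 4 from rfl] at hcs
  exact (pow_le_pow_iff_left₀ (massDev_nonneg π ν) (dev4_nonneg π ν) (by norm_num)).mp hcs

/-- Multiples of `π` have `L⁴` deviation zero (`π` positive, `Σ π = 1`). -/
theorem dev4_mul_self {π : X → ℝ} (hπ : ∀ x, 0 < π x) (hπ1 : ∑ x, π x = 1) (c : ℝ) :
    dev4 π (fun x => c * π x) = 0 := by
  unfold dev4
  have h0 : ∑ x, π x * (c * π x / π x - ∑ y, c * π y) ^ 4 = 0 := by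
    refine sum_eq_zero fun x _ => ?_
    rw [← mul_sum, hπ1, mul_one, mul_div_assoc, div_self (hπ x).ne', mul_one, sub_self]
    simp
  rw [h0, Real.sqrt_zero, Real.sqrt_zero]

/-! ## §3 Hypercontractive layers -/

/-- **`HyperContracts K π ρ`** — the layer `K` maps zero-mass `L²(1/π)` deviations to `L⁴(π)`
deviation densities with norm `ρ`: for every `ξ` with `Σ ξ = 0`,
`Σ_y π(y)·((ξK)(y)/π(y))⁴ ≤ ρ⁴·(Σ_x ξ(x)²/π(x))²`.  For a `π`-reversible `K` this reads
`‖Kh‖_{L⁴(π)} ≤ ρ‖h‖_{L²(π)}` on `π`-mean-zero `h` (hypercontractivity on the complement of the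
constants). -/
def HyperContracts (K : X → X → ℝ) (π : X → ℝ) (ρ : ℝ) : Prop :=
  ∀ ξ : X → ℝ, ∑ x, ξ x = 0 →
    ∑ y, π y * (stepLaw K ξ y / π y) ^ 4 ≤ ρ ^ 4 * (∑ x, ξ x ^ 2 / π x) ^ 2

/-- Perfect relaxation `K(x, ·) = π` kills every zero-mass input: `HyperContracts K π 0`. -/
theorem hyperContracts_perfect (π : X → ℝ) : HyperContracts (fun _ y => π y) π 0 := by
  intro ξ hξ
  have h0 : ∀ y, stepLaw (fun _ y => π y) ξ y = 0 := by
    intro y; unfold stepLaw; rw [← sum_mul, hξ, zero_mul]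
  simp_rw [h0, zero_div]
  simp

/-- Monotonicity in the constant. -/
theorem HyperContracts.mono {K : X → X → ℝ} {π : X → ℝ} {ρ ρ' : ℝ} (h : HyperContracts K π ρ)
    (hρ : 0 ≤ ρ) (hρρ' : ρ ≤ ρ') : HyperContracts K π ρ' := by
  intro ξ hξ
  refine (h ξ hξ).trans (mul_le_mul_of_nonneg_right ?_ (sq_nonneg _))
  exact pow_le_pow_left₀ hρ hρρ' 4

/-- A hypercontractive layer contracts zero-mass deviations in `L²(1/π)` by the same `ρ`
(Lyapunov `‖·‖_{L²(π)} ≤ ‖·‖_{L⁴(π)}` on a probability vector): the `χ²`-contraction of the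
staged `χ²` route follows from `HyperContracts`. -/
theorem HyperContracts.sum_sq_div_le {K : X → X → ℝ} {π : X → ℝ} {ρ : ℝ}
    (h : HyperContracts K π ρ) (hπ : ∀ x, 0 < π x) (hπ1 : ∑ x, π x = 1)
    {ξ : X → ℝ} (hξ : ∑ x, ξ x = 0) :
    ∑ y, stepLaw K ξ y ^ 2 / π y ≤ ρ ^ 2 * ∑ x, ξ x ^ 2 / π x := by
  have hπ0 : ∀ x, 0 ≤ π x := fun x => (hπ x).le
  set w : X → ℝ := fun y => stepLaw K ξ y / π y with hw
  have hcs := sq_sum_mul_mul_le hπ0 (fun y => w y ^ 2) (fun _ => 1)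
  have e1 : ∑ y, π y * w y ^ 2 * 1 = ∑ y, stepLaw K ξ y ^ 2 / π y := by
    refine sum_congr rfl fun y _ => ?_; rw [hw]; field_simp [(hπ y).ne']
  have e2 : ∑ y, π y * (w y ^ 2) ^ 2 = ∑ y, π y * (stepLaw K ξ y / π y) ^ 4 :=
    sum_congr rfl fun y _ => by rw [hw]; ring
  have e3 : ∑ y, π y * (1:ℝ) ^ 2 = 1 := by simp [hπ1]
  rw [e1, e2, e3, mul_one] at hcs
  have h4 := hcs.trans (h ξ hξ)
  have hA : 0 ≤ ∑ y, stepLaw K ξ y ^ 2 / π y :=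
    sum_nonneg fun y _ => div_nonneg (sq_nonneg _) (hπ y).le
  have hB : 0 ≤ ρ ^ 2 * ∑ x, ξ x ^ 2 / π x :=
    mul_nonneg (sq_nonneg _) (sum_nonneg fun x _ => div_nonneg (sq_nonneg _) (hπ x).le)
  rw [show ρ ^ 4 * (∑ x, ξ x ^ 2 / π x) ^ 2 = (ρ ^ 2 * ∑ x, ξ x ^ 2 / π x) ^ 2 by ring] at h4
  exact (pow_le_pow_iff_left₀ hA hB two_ne_zero).mp h4

/-! ## §4 The two steps of the tilted recursion -/

/-- The own-mass multiple of `π'` is the best constant multiple in `L²(1/π')`: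
`massDev π' ζ ≤ √(Σ (ζ − c·π')²/π')` for every `c` (`Σ π' = 1`). -/
theorem massDev_le_sqrt_sum_shift_sq_div {π' : X → ℝ} (hπ' : ∀ x, 0 < π' x)
    (hπ'1 : ∑ x, π' x = 1) (ζ : X → ℝ) (c : ℝ) :
    massDev π' ζ ≤ Real.sqrt (∑ x, (ζ x - c * π' x) ^ 2 / π' x) := by
  set m := ∑ x, ζ x with hm
  have hid : ∑ x, (ζ x - c * π' x) ^ 2 / π' x
      = ∑ x, (ζ x - m * π' x) ^ 2 / π' x + (m - c) ^ 2 := by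
    have e : ∀ x, (ζ x - c * π' x) ^ 2 / π' x
        = (ζ x - m * π' x) ^ 2 / π' x + 2 * (m - c) * (ζ x - m * π' x)
          + (m - c) ^ 2 * π' x := by
      intro x; field_simp [(hπ' x).ne']; ring
    simp_rw [e, sum_add_distrib, ← mul_sum, sum_sub_distrib, ← mul_sum, hπ'1, ← hm]
    ring
  rw [← Real.sqrt_sq (massDev_nonneg π' ζ), massDev_sq hπ', ← hm, hid]
  exact Real.sqrt_le_sqrt (le_add_of_nonneg_right (sq_nonneg _))

/-- For a `π'`-stationary layer, shifting the input by a multiple of `π'` shifts the output by the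
same multiple: `ζK − c·π' = (ζ − c·π')K`. -/
theorem stepLaw_shift_of_stationary {K : X → X → ℝ} {π' : X → ℝ} (hst : IsStationary π' K)
    (ζ : X → ℝ) (c : ℝ) (y : X) :
    stepLaw K ζ y - c * π' y = stepLaw K (fun x => ζ x - c * π' x) y := by
  unfold stepLaw
  rw [← hst y, mul_sum, ← sum_sub_distrib]
  exact sum_congr rfl fun x _ => by ring

/-- **THE HYPERCONTRACTIVE STEP.**  For a `π'`-stationary layer with unit row sums and
`HyperContracts K π' ρ` (`ρ ≥ 0`): `dev4 π' (ζK) ≤ ρ · massDev π' ζ` for EVERY `ζ` — the `L²(1/π')`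
deviation of the input becomes an `L⁴(π')` deviation density of the output, contracted by `ρ`. -/
theorem dev4_stepLaw_le {K : X → X → ℝ} {π' : X → ℝ} {ρ : ℝ} (hπ' : ∀ x, 0 < π' x)
    (hπ'1 : ∑ x, π' x = 1) (hrow : ∀ x, ∑ y, K x y = 1) (hst : IsStationary π' K)
    (hK : HyperContracts K π' ρ) (hρ : 0 ≤ ρ) (ζ : X → ℝ) :
    dev4 π' (stepLaw K ζ) ≤ ρ * massDev π' ζ := by
  set m := ∑ x, ζ x with hm
  have hπ'0 : ∀ x, 0 ≤ π' x := fun x => (hπ' x).le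
  have hmass : ∑ y, stepLaw K ζ y = m := by
    unfold stepLaw
    rw [sum_comm]
    exact (sum_congr rfl fun x _ => by rw [← mul_sum, hrow x, mul_one]).trans hm.symm
  set ξ : X → ℝ := fun x => ζ x - m * π' x with hξ
  have hξ0 : ∑ x, ξ x = 0 := by
    rw [hξ]; simp only; rw [sum_sub_distrib, ← mul_sum, hπ'1, ← hm]; ring
  have h4 : dev4 π' (stepLaw K ζ) ^ 4 = ∑ y, π' y * (stepLaw K ξ y / π' y) ^ 4 := by
    rw [dev4_pow_four hπ'0, hmass]
    refine sum_congr rfl fun y _ => ?_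
    rw [← stepLaw_shift_of_stationary hst ζ m y]
    congr 2
    field_simp [(hπ' y).ne']
  have hξsq : ∑ x, ξ x ^ 2 / π' x = massDev π' ζ ^ 2 := by rw [massDev_sq hπ', ← hm]
  have hle : dev4 π' (stepLaw K ζ) ^ 4 ≤ (ρ * massDev π' ζ) ^ 4 := by
    rw [h4, mul_pow, show massDev π' ζ ^ 4 = (massDev π' ζ ^ 2) ^ 2 by ring, ← hξsq]
    exact hK ξ hξ0
  exact (pow_le_pow_iff_left₀ (dev4_nonneg _ _) (mul_nonneg hρ (massDev_nonneg _ _))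
    (by norm_num)).mp hle

/-- **THE SUP-NORM-FREE TILT STEP.**  For a positive `π`, a positive probability vector `π'`, a
weight `g` with
`π[g] > 0` and any `ν`:
`massDev π' (g·ν) ≤ (Σ_x g(x)⁴π(x)³/π'(x)²)^{1/4} · dev4 π ν + |Σν| · π[g] · √χ²(T_g π ‖ π')`,
`T_g π = g·π/π[g]` (Hölder on the deviation density, `χ²` for the equilibrium part; the first
coefficient is `‖g²π/π'‖_{L²(π)}^{1/2}`, an exponential MOMENT of `g`, not a supremum). -/
theorem massDev_tilt_le_of_dev4 {π π' ν g : X → ℝ} (hπ : ∀ x, 0 < π x)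
    (hπ' : ∀ x, 0 < π' x) (hπ'1 : ∑ x, π' x = 1) (hg : 0 < ∑ x, π x * g x) :
    massDev π' (fun x => g x * ν x)
      ≤ Real.sqrt (Real.sqrt (∑ x, g x ^ 4 * π x ^ 3 / π' x ^ 2)) * dev4 π ν
        + |∑ x, ν x| * (∑ x, π x * g x)
            * Real.sqrt (chiSqDiv (fun x => π x * g x / ∑ y, π y * g y) π') := by
  set m := ∑ x, ν x with hm
  set gbar := ∑ x, π x * g x with hgbar
  set h : X → ℝ := fun x => ν x / π x - m with hh
  have hπ0 : ∀ x, 0 ≤ π x := fun x => (hπ x).le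
  -- the two pieces of g·ν − m·ḡ·π'
  set u : X → ℝ := fun x => g x * π x * h x with hu
  set v : X → ℝ := fun x => m * (g x * π x - gbar * π' x) with hv
  have hsplit : ∀ x, g x * ν x - m * gbar * π' x = u x + v x := by
    intro x; rw [hu, hv, hh]; field_simp [(hπ x).ne']; ring
  -- piece u: Hölder
  set C4 := ∑ x, g x ^ 4 * π x ^ 3 / π' x ^ 2 with hC4
  have hC40 : 0 ≤ C4 := sum_nonneg fun x _ =>
    div_nonneg (mul_nonneg (by positivity) (pow_nonneg (hπ0 x) 3)) (sq_nonneg _)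
  have hU : Real.sqrt (∑ x, u x ^ 2 / π' x) ≤ Real.sqrt (Real.sqrt C4) * dev4 π ν := by
    have hcs := sq_sum_mul_mul_le hπ0 (fun x => g x ^ 2 * π x / π' x) (fun x => h x ^ 2)
    have e1 : ∑ x, π x * (g x ^ 2 * π x / π' x) * h x ^ 2 = ∑ x, u x ^ 2 / π' x := by
      refine sum_congr rfl fun x _ => ?_; rw [hu]; field_simp [(hπ' x).ne']
    have e2 : ∑ x, π x * (g x ^ 2 * π x / π' x) ^ 2 = C4 := by
      rw [hC4]; refine sum_congr rfl fun x _ => ?_; field_simp [(hπ' x).ne']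
    have e3 : ∑ x, π x * (h x ^ 2) ^ 2 = dev4 π ν ^ 4 := by
      rw [dev4_pow_four hπ0, ← hm]
      exact sum_congr rfl fun x _ => by rw [hh]; ring
    rw [e1, e2, e3] at hcs
    have hS0 : 0 ≤ ∑ x, u x ^ 2 / π' x := sum_nonneg fun x _ => div_nonneg (sq_nonneg _) (hπ' x).le
    have hd := dev4_nonneg π ν
    -- (Σu²/π')² ≤ C4·dev4⁴ = (√C4·dev4²)²
    have h1 : ∑ x, u x ^ 2 / π' x ≤ Real.sqrt C4 * dev4 π ν ^ 2 := by
      have : (∑ x, u x ^ 2 / π' x) ^ 2 ≤ (Real.sqrt C4 * dev4 π ν ^ 2) ^ 2 := by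
        rw [mul_pow, Real.sq_sqrt hC40, ← pow_mul]; exact hcs
      exact (pow_le_pow_iff_left₀ hS0 (by positivity) two_ne_zero).mp this
    calc Real.sqrt (∑ x, u x ^ 2 / π' x) ≤ Real.sqrt (Real.sqrt C4 * dev4 π ν ^ 2) :=
          Real.sqrt_le_sqrt h1
      _ = Real.sqrt (Real.sqrt C4) * dev4 π ν := by
          rw [Real.sqrt_mul (Real.sqrt_nonneg _), Real.sqrt_sq hd]
  -- piece v: χ² of the tilted law
  have hV : Real.sqrt (∑ x, v x ^ 2 / π' x)
      ≤ |m| * gbar * Real.sqrt (chiSqDiv (fun x => π x * g x / gbar) π') := by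
    refine le_of_eq ?_
    rw [chiSqDiv_eq_sum_sq_div]
    have e : ∑ x, v x ^ 2 / π' x = (m * gbar) ^ 2 * ∑ x, (π x * g x / gbar - π' x) ^ 2 / π' x := by
      rw [mul_sum]
      refine sum_congr rfl fun x _ => ?_
      simp only [hv]
      have : m * (g x * π x - gbar * π' x) = (m * gbar) * (π x * g x / gbar - π' x) := by
        field_simp [hg.ne']
      rw [this, mul_pow]; ring
    rw [e, Real.sqrt_mul (sq_nonneg _), Real.sqrt_sq_eq_abs, abs_mul, abs_of_pos hg]
  -- assemble
  have hmink := sqrt_sum_add_sq_div_le_add hπ' hU hV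
  have hbest := massDev_le_sqrt_sum_shift_sq_div hπ' hπ'1 (fun x => g x * ν x) (m * gbar)
  have e : ∑ x, (g x * ν x - m * gbar * π' x) ^ 2 / π' x = ∑ x, (u x + v x) ^ 2 / π' x :=
    sum_congr rfl fun x _ => by rw [hsplit]
  rw [e] at hbest
  exact hbest.trans hmink

/-- **THE DEVIATION STEP OF THE TILTED RECURSION (tilt, then a hypercontractive layer).**
`dev4 π' ((g·ν)K) ≤ ρ·((Σ g⁴π³/π'²)^{1/4}·dev4 π ν + |Σν|·π[g]·√χ²(T_gπ ‖ π'))`. -/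
theorem dev4_tilt_stepLaw_le {K : X → X → ℝ} {π π' ν g : X → ℝ} {ρ : ℝ} (hπ : ∀ x, 0 < π x)
    (hπ' : ∀ x, 0 < π' x) (hπ'1 : ∑ x, π' x = 1)
    (hg : 0 < ∑ x, π x * g x) (hrow : ∀ x, ∑ y, K x y = 1) (hst : IsStationary π' K)
    (hK : HyperContracts K π' ρ) (hρ : 0 ≤ ρ) :
    dev4 π' (stepLaw K (fun x => g x * ν x))
      ≤ ρ * (Real.sqrt (Real.sqrt (∑ x, g x ^ 4 * π x ^ 3 / π' x ^ 2)) * dev4 π ν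
          + |∑ x, ν x| * (∑ x, π x * g x)
              * Real.sqrt (chiSqDiv (fun x => π x * g x / ∑ y, π y * g y) π')) :=
  (dev4_stepLaw_le hπ' hπ'1 hrow hst hK hρ _).trans
    (mul_le_mul_of_nonneg_left (massDev_tilt_le_of_dev4 hπ hπ' hπ'1 hg) hρ)

end Summit.Ventures.LatticeQCDFlow.Scaling
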